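import Mathlib
import Literature.Analysis.FluidPDE.VorticityEquation
import Literature.Analysis.FluidPDE.ConstantinDirectionDissipationCalculus
import Literature.Analysis.FluidPDE.SpaceTimeCalculus
import Literature.Analysis.FluidPDE.HessianLaplacian
import Literature.Analysis.FluidPDE.LerayProfileCalculus
import Literature.Analysis.FluidPDE.VorticityCalculus
import Literature.Analysis.FluidPDE.TypeIAncientMildClassical
import HarnessLib

/-!
# Kato's inequality with a stretching certificate: the pointwise subsolution computation
(route `SymmetryModuliCount`, item stmt-NavierStokesRegularity-14340 `StretchingCertificateComparison`,
helper file)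

For a velocity field `u` (jointly smooth on `t < 0`) with vorticity `ω = curl u` satisfying the
vorticity equation `∂ₜω + (u·∇)ω = (ω·∇)u + Δω`, and a positive jointly smooth weight `h`
("stretching certificate") satisfying, wherever `ω ≠ 0`,
`((−t)(⟪∇u ξ, ξ⟫ − |∇ξ|²_F) − 1 + δ) h ≤ (−t)(∂ₜh + u·∇h − Δh)` (`ξ = ω/|ω|`), the SMOOTH
quotient `F = |ω|²/h²` satisfies at every point with `ω ≠ 0`
`∂ₜF + u·∇F − ΔF ≤ 2(1−δ)F/(−t) + 2h⁻¹ ∇F·∇h` (`stretchCert_F_subsolution`).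
This is Kato's inequality for `|ω|` (Constantin 1990, (2.9); Constantin–Fefferman 1993, §1, the
stretching formula `(∂ₜ + u·∇ − Δ)|ω| = (ξ·Sξ)|ω| − |ω||∇ξ|²`) combined with the certificate,
written for the square `|ω|²/h²` so that no regularisation at `{ω = 0}` is needed; the discarded
term is the exact square `−h²|∇F|²/(2F)`.

Contents: the real-arithmetic core (`stretchCert_algebra`), the slice calculus
(`Δ|ω|² = 2⟪Δω, ω⟫ + 2|∇ω|²_F`, product rules for `|ω|² = F·h²`), the slice form
(`stretchCert_slice`, using the tree's `norm_mul_frobeniusNormSq_fderiv_vorticityDirection` for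
`|ω|⁴|∇ξ|² = |ω|²|∇ω|² − ¼|∇|ω|²|²`), the vorticity equation of the Type-I ancient mild class in
two-sided form (`vorticity_eq_deriv_of_typeI`), and the space–time form.

## References

* P. Constantin, Comm. Math. Phys. 129 (1990) 241–266, §2 (2.9). [Constantin1990]
* P. Constantin, C. Fefferman, Indiana Univ. Math. J. 42 (1993) 775–789, §1. [ConstantinFefferman1993]
* A. J. Majda, A. L. Bertozzi, *Vorticity and Incompressible Flow*, CUP 2002, §2.4 (2.110).
  [MajdaBertozziCUP2002]
-/

noncomputable section

set_option linter.dupNamespace false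

open Set Function Filter
open scoped RealInnerProductSpace Laplacian ContDiff Topology

namespace Summit.NavierStokesRegularity.NavierStokesRegularity.Theorems

open Literature.Analysis Literature.Analysis.FluidPDE

/-! ### Real arithmetic -/

/-- **The real-arithmetic core of the certificate comparison.** At a point where the vorticity
modulus `q = |ω|² > 0`, with certificate value `hx > 0`, `F = q/hx²`, `mt = −t > 0`: the Kato
bookkeeping `q² Ξ = q W − ¼|∇q|²` (`Ξ = |∇ξ|²_F`, `W = |∇ω|²_F`), the transport identity
`hx² LF + 2F hx Lh − 2F Σhᵢ² − 4hx ΣFᵢhᵢ = Lq = 2qσ − 2W` (`L = ∂ₜ + u·∇ − Δ`, product rules for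
`q = F h²`), the certificate inequality `(mt(σ − Ξ) − 1 + δ) hx ≤ mt Lh` and
`|∇q|² = hx⁴ΣFᵢ² + 4Fhx³ΣFᵢhᵢ + 4F²hx²Σhᵢ²` give `LF ≤ 2(1−δ)F/mt + 2 hx⁻¹ ΣFᵢhᵢ`
(the discarded term is `−hx²|∇F|²/(2F) ≤ 0`). [folklore] -/
theorem stretchCert_algebra {q hx F mt δ σ Ξ W Lh LF Sqq SFF SFh Shh : ℝ}
    (hq : 0 < q) (hh : 0 < hx) (hmt : 0 < mt) (hF : q = F * hx ^ 2)
    (hkato : q ^ 2 * Ξ = q * W - Sqq / 4)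
    (hLq : hx ^ 2 * LF + 2 * F * hx * Lh - 2 * F * Shh - 4 * hx * SFh = 2 * q * σ - 2 * W)
    (hcert : (mt * (σ - Ξ) - 1 + δ) * hx ≤ mt * Lh)
    (hSqq : Sqq = hx ^ 4 * SFF + 4 * F * hx ^ 3 * SFh + 4 * F ^ 2 * hx ^ 2 * Shh)
    (hSFF : 0 ≤ SFF) :
    LF ≤ 2 * (1 - δ) / mt * F + 2 * hx⁻¹ * SFh := by
  have hF0 : 0 < F := by
    have h1 : 0 < F * hx ^ 2 := hF ▸ hq
    exact pos_of_mul_pos_left h1 (by positivity)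
  have e1 : hx ^ 2 * LF = 2 * q * σ - 2 * W - 2 * F * hx * Lh + 2 * F * Shh + 4 * hx * SFh := by
    linarith
  have e2 : q * (2 * W) = 2 * q ^ 2 * Ξ + Sqq / 2 := by linear_combination (-2) * hkato
  have h1 : mt * q * (hx ^ 2 * LF) = 2 * mt * q ^ 2 * σ - mt * (2 * q ^ 2 * Ξ + Sqq / 2)
      - 2 * q * F * hx * (mt * Lh) + 2 * mt * q * F * Shh + 4 * mt * q * hx * SFh := by
    rw [e1]; linear_combination (-mt) * e2
  have h2 : 2 * q * F * hx * ((mt * (σ - Ξ) - 1 + δ) * hx) ≤ 2 * q * F * hx * (mt * Lh) :=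
    mul_le_mul_of_nonneg_left hcert (by positivity)
  have h3 : 2 * mt * q ^ 2 * σ - mt * (2 * q ^ 2 * Ξ + Sqq / 2)
      - 2 * q * F * hx * ((mt * (σ - Ξ) - 1 + δ) * hx) + 2 * mt * q * F * Shh + 4 * mt * q * hx * SFh
      = 2 * q ^ 2 * (1 - δ) - mt * hx ^ 4 * SFF / 2 + 2 * mt * F * hx ^ 3 * SFh := by
    subst hSqq; subst hF; ring
  have h4 : 0 ≤ mt * hx ^ 4 * SFF / 2 := by positivity
  have key : mt * q * (hx ^ 2 * LF) ≤ 2 * q ^ 2 * (1 - δ) + 2 * mt * F * hx ^ 3 * SFh := by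
    linarith
  have hpos : 0 < mt * q * hx ^ 2 := by positivity
  refine le_of_mul_le_mul_left ?_ hpos
  have e3 : mt * q * hx ^ 2 * (2 * (1 - δ) / mt * F + 2 * hx⁻¹ * SFh)
      = 2 * q * (F * hx ^ 2) * (1 - δ) + 2 * mt * q * hx * SFh := by
    field_simp
  rw [e3, ← hF]
  have e4 : 2 * mt * F * hx ^ 3 * SFh = 2 * mt * (F * hx ^ 2) * hx * SFh := by ring
  rw [e4, ← hF] at key
  have e5 : mt * q * hx ^ 2 * LF = mt * q * (hx ^ 2 * LF) := by ring
  rw [e5]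
  linarith

/-! ### Slice calculus -/

/-- `D(|ω|²)(x) w = 2⟪ω(x), Dω(x) w⟫`. [folklore] -/
theorem fderiv_norm_sq_comp_apply {Om : EuclideanSpace ℝ (Fin 3) → EuclideanSpace ℝ (Fin 3)}
    {x : EuclideanSpace ℝ (Fin 3)} (hOm : DifferentiableAt ℝ Om x) (w : EuclideanSpace ℝ (Fin 3)) :
    fderiv ℝ (fun y => ‖Om y‖ ^ 2) x w = 2 * ⟪Om x, fderiv ℝ Om x w⟫ := by
  have h : HasFDerivAt (fun y => ‖Om y‖ ^ 2) ((2 : ℕ) • (innerSL ℝ (Om x)).comp (fderiv ℝ Om x)) x :=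
    hOm.hasFDerivAt.norm_sq
  rw [h.fderiv]
  simp [innerSL_apply_apply, nsmul_eq_mul]

/-- `Δ|ω|² = 2⟪Δω, ω⟫ + 2|Dω|²_F` for a `C²` field. [folklore] -/
theorem laplacian_norm_sq_comp {Om : EuclideanSpace ℝ (Fin 3) → EuclideanSpace ℝ (Fin 3)}
    (hOm : ContDiff ℝ 2 Om) (x : EuclideanSpace ℝ (Fin 3)) :
    (Δ (fun y => ‖Om y‖ ^ 2)) x = 2 * ⟪(Δ Om) x, Om x⟫ + 2 * frobeniusNormSq (fderiv ℝ Om x) := by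
  have e : (fun y => ‖Om y‖ ^ 2) = fun y => ⟪Om y, Om y⟫ :=
    funext fun y => (real_inner_self_eq_norm_sq _).symm
  rw [e]
  exact laplacian_inner_self_eq hOm x

/-- Product rules for `q = F · k²`: gradient and Laplacian of `q` in terms of those of `F` and
`k`, in an orthonormal frame `b`. [folklore] -/
theorem fderiv_laplacian_mul_sq {F k : EuclideanSpace ℝ (Fin 3) → ℝ} (hF : ContDiff ℝ 2 F)
    (hk : ContDiff ℝ 2 k) (x : EuclideanSpace ℝ (Fin 3)) :
    (∀ w, fderiv ℝ (fun y => F y * (k y * k y)) x w =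
        k x ^ 2 * fderiv ℝ F x w + 2 * F x * k x * fderiv ℝ k x w) ∧
      (Δ (fun y => F y * (k y * k y))) x =
        k x ^ 2 * (Δ F) x + F x * (2 * k x * (Δ k) x
          + 2 * ∑ i, fderiv ℝ k x (stdOrthonormalBasis ℝ (EuclideanSpace ℝ (Fin 3)) i) ^ 2)
          + 4 * k x * ∑ i, fderiv ℝ F x (stdOrthonormalBasis ℝ (EuclideanSpace ℝ (Fin 3)) i)
              * fderiv ℝ k x (stdOrthonormalBasis ℝ (EuclideanSpace ℝ (Fin 3)) i) := by
  set b := stdOrthonormalBasis ℝ (EuclideanSpace ℝ (Fin 3)) with hb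
  have hkk : ContDiff ℝ 2 fun y => k y * k y := hk.mul hk
  have hFd : DifferentiableAt ℝ F x := (hF.differentiable two_ne_zero) x
  have hkd : ∀ y, DifferentiableAt ℝ k y := fun y => (hk.differentiable two_ne_zero) y
  have hkkd : DifferentiableAt ℝ (fun y => k y * k y) x := (hkd x).mul (hkd x)
  have hDkk : ∀ y w, fderiv ℝ (fun y => k y * k y) y w = 2 * k y * fderiv ℝ k y w := by
    intro y w
    rw [fderiv_fun_mul (hkd y) (hkd y)]
    simp only [_root_.add_apply, FunLike.coe_smul, Pi.smul_apply,
      smul_eq_mul]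
    ring
  refine ⟨fun w => ?_, ?_⟩
  · rw [fderiv_fun_mul hFd hkkd]
    simp only [_root_.add_apply, FunLike.coe_smul, Pi.smul_apply,
      smul_eq_mul, hDkk]
    ring
  · rw [laplacian_mul_eq b hF hkk x, laplacian_mul_eq b hk hk x]
    simp only [hDkk]
    have e1 : ∑ i, fderiv ℝ F x (b i) * (2 * k x * fderiv ℝ k x (b i)) =
        2 * k x * ∑ i, fderiv ℝ F x (b i) * fderiv ℝ k x (b i) := by
      rw [Finset.mul_sum]
      exact Finset.sum_congr rfl fun i _ => by ring
    have e2 : ∑ i, fderiv ℝ k x (b i) * fderiv ℝ k x (b i) = ∑ i, fderiv ℝ k x (b i) ^ 2 :=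
      Finset.sum_congr rfl fun i _ => by ring
    rw [e1, e2]
    ring


/-! ### The pointwise inequality on a slice -/

/-- **Kato + certificate, slice form.** Let `Om` (a vorticity slice) and `k > 0` (a certificate
slice) be `C²`, `x` a point with `Om x ≠ 0`, and let the numbers `Omt` (`= ∂ₜω`), `kt` (`= ∂ₜh`),
`Ft` (`= ∂ₜ(|ω|²/h²)`), `mt = −t > 0` satisfy: the time product rule
`2⟪ω, ∂ₜω⟫ = h²Ft + 2F h ∂ₜh`, the vorticity equation `∂ₜω + Dω v = Dv ω + Δω` at `x`, and the
certificate inequality `(mt(⟪Dv ξ, ξ⟫ − |Dξ|²_F) − 1 + δ) h ≤ mt(∂ₜh + Dh v − Δh)` at `x`. Then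
`F = |ω|²/h²` satisfies at `x`
`Ft + DF v − ΔF ≤ 2(1−δ)F/mt + 2h⁻¹ Σᵢ ∂ᵢF ∂ᵢh`.
Ingredients: `Δ|ω|² = 2⟪Δω, ω⟫ + 2|Dω|²` and Kato's identity
`|ω|⁴|Dξ|²_F = |ω|²|Dω|²_F − Σᵢ⟪ω, ∂ᵢω⟫²` (`norm_mul_frobeniusNormSq_fderiv_vorticityDirection`),
the product rules for `|ω|² = F·h²`, and `stretchCert_algebra`.
[cite: Constantin1990, (2.9)] -/
theorem stretchCert_slice {v Om : EuclideanSpace ℝ (Fin 3) → EuclideanSpace ℝ (Fin 3)}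
    {k : EuclideanSpace ℝ (Fin 3) → ℝ} (hOm : ContDiff ℝ 2 Om) (hk : ContDiff ℝ 2 k)
    (hk0 : ∀ y, k y ≠ 0) {x : EuclideanSpace ℝ (Fin 3)} (hx : Om x ≠ 0) (hkx : 0 < k x)
    {Omt : EuclideanSpace ℝ (Fin 3)} {kt Ft mt δ : ℝ} (hmt : 0 < mt)
    (htime : 2 * ⟪Om x, Omt⟫ = k x ^ 2 * Ft + 2 * (‖Om x‖ ^ 2 / k x ^ 2) * k x * kt)
    (hvort : Omt + fderiv ℝ Om x (v x) = fderiv ℝ v x (Om x) + (Δ Om) x)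
    (hcert : (mt * (⟪fderiv ℝ v x (vorticityDirection Om x), vorticityDirection Om x⟫
        - frobeniusNormSq (fderiv ℝ (vorticityDirection Om) x)) - 1 + δ) * k x ≤
      mt * (kt + fderiv ℝ k x (v x) - (Δ k) x)) :
    Ft + fderiv ℝ (fun y => ‖Om y‖ ^ 2 / k y ^ 2) x (v x)
        - (Δ fun y => ‖Om y‖ ^ 2 / k y ^ 2) x ≤
      2 * (1 - δ) / mt * (‖Om x‖ ^ 2 / k x ^ 2)
        + 2 * (k x)⁻¹ * ∑ i, fderiv ℝ (fun y => ‖Om y‖ ^ 2 / k y ^ 2) x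
            (stdOrthonormalBasis ℝ (EuclideanSpace ℝ (Fin 3)) i)
          * fderiv ℝ k x (stdOrthonormalBasis ℝ (EuclideanSpace ℝ (Fin 3)) i) := by
  set b := stdOrthonormalBasis ℝ (EuclideanSpace ℝ (Fin 3)) with hb
  set q : EuclideanSpace ℝ (Fin 3) → ℝ := fun y => ‖Om y‖ ^ 2 with hqdef
  set F : EuclideanSpace ℝ (Fin 3) → ℝ := fun y => ‖Om y‖ ^ 2 / k y ^ 2 with hFdef
  -- smoothness
  have hq2 : ContDiff ℝ 2 q := (contDiff_norm_sq ℝ).comp hOm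
  have hF2 : ContDiff ℝ 2 F := hq2.div (hk.pow 2) fun y => pow_ne_zero 2 (hk0 y)
  have hOmd : DifferentiableAt ℝ Om x := (hOm.differentiable two_ne_zero) x
  -- `q = F · k²` as functions
  have hqF : q = fun y => F y * (k y * k y) := by
    funext y
    simp only [hqdef, hFdef]
    field_simp [hk0 y]
  -- first and second derivatives of `q`, two ways
  have hDq : ∀ w, fderiv ℝ q x w = 2 * ⟪Om x, fderiv ℝ Om x w⟫ := fun w =>
    fderiv_norm_sq_comp_apply hOmd w
  have hΔq : (Δ q) x = 2 * ⟪(Δ Om) x, Om x⟫ + 2 * frobeniusNormSq (fderiv ℝ Om x) :=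
    laplacian_norm_sq_comp hOm x
  obtain ⟨hDq', hΔq'⟩ := fderiv_laplacian_mul_sq hF2 hk x
  rw [← hqF] at hDq' hΔq'
  -- Kato's identity
  have hkato0 := norm_mul_frobeniusNormSq_fderiv_vorticityDirection hOmd
  rw [regN_zero, ← hb] at hkato0
  -- names for the numbers
  set n : ℝ := ‖Om x‖ with hn
  have hn0 : 0 < n := norm_pos_iff.2 hx
  set kx : ℝ := k x with hkxdef
  set DOm := fderiv ℝ Om x with hDOm
  set Dv := fderiv ℝ v x with hDv
  set Dk := fderiv ℝ k x with hDk
  set DF := fderiv ℝ F x with hDF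
  set Ξ : ℝ := frobeniusNormSq (fderiv ℝ (vorticityDirection Om) x) with hΞ
  set W : ℝ := frobeniusNormSq DOm with hW
  set σ : ℝ := ⟪Dv (vorticityDirection Om x), vorticityDirection Om x⟫ with hσ
  set Sqq : ℝ := ∑ i, fderiv ℝ q x (b i) ^ 2 with hSqq
  set SFF : ℝ := ∑ i, DF (b i) ^ 2 with hSFF
  set SFh : ℝ := ∑ i, DF (b i) * Dk (b i) with hSFh
  set Shh : ℝ := ∑ i, Dk (b i) ^ 2 with hShh
  have hFx : F x = n ^ 2 / kx ^ 2 := rfl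
  -- the hypotheses of the algebraic lemma
  have hFrel : n ^ 2 = F x * kx ^ 2 := by
    rw [hFx]; field_simp
  have hWsum : W = ∑ i, ‖DOm (b i)‖ ^ 2 := rfl
  have hkato : (n ^ 2) ^ 2 * Ξ = n ^ 2 * W - Sqq / 4 := by
    have hN : n * Ξ * n ^ 3 = ∑ i, (‖DOm (b i)‖ ^ 2 * n ^ 2 - ⟪Om x, DOm (b i)⟫ ^ 2) := by
      rw [hkato0]; field_simp
      exact Finset.sum_congr rfl fun i _ => by ring
    have hS : Sqq = ∑ i, (2 * ⟪Om x, DOm (b i)⟫) ^ 2 := Finset.sum_congr rfl fun i _ => by rw [hDq]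
    rw [hWsum, hS, Finset.mul_sum, Finset.sum_div, ← Finset.sum_sub_distrib]
    calc (n ^ 2) ^ 2 * Ξ = n * Ξ * n ^ 3 := by ring
      _ = ∑ i, (‖DOm (b i)‖ ^ 2 * n ^ 2 - ⟪Om x, DOm (b i)⟫ ^ 2) := hN
      _ = ∑ i, (n ^ 2 * ‖DOm (b i)‖ ^ 2 - (2 * ⟪Om x, DOm (b i)⟫) ^ 2 / 4) :=
          Finset.sum_congr rfl fun i _ => by ring
  have hσ' : 2 * ⟪Om x, Dv (Om x)⟫ = 2 * n ^ 2 * σ := by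
    rw [hσ, vorticityDirection_apply, map_smul, real_inner_smul_left, real_inner_smul_right,
      real_inner_comm (Om x)]
    rw [← hn]
    field_simp
  have hLq : kx ^ 2 * (Ft + DF (v x) - (Δ F) x) + 2 * F x * kx * (kt + Dk (v x) - (Δ k) x)
      - 2 * F x * Shh - 4 * kx * SFh = 2 * n ^ 2 * σ - 2 * W := by
    -- `Lq = qₜ + Dq v − Δq` computed from `q = |ω|²` and the vorticity equation …
    have hLq1 : 2 * ⟪Om x, Omt⟫ + fderiv ℝ q x (v x) - (Δ q) x = 2 * n ^ 2 * σ - 2 * W := by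
      have hc : ⟪(Δ Om) x, Om x⟫ = ⟪Om x, (Δ Om) x⟫ := real_inner_comm _ _
      rw [hDq, hΔq, ← hσ', hc]
      have e : Omt = Dv (Om x) + (Δ Om) x - DOm (v x) := by rw [← hvort]; abel
      rw [e, inner_sub_right, inner_add_right]
      ring
    -- … and from `q = F h²`
    rw [hDq', hΔq'] at hLq1
    rw [← hLq1, htime]
    ring
  have hSqq' : Sqq = kx ^ 4 * SFF + 4 * F x * kx ^ 3 * SFh + 4 * F x ^ 2 * kx ^ 2 * Shh := by
    rw [hSqq, hSFF, hSFh, hShh, Finset.mul_sum, Finset.mul_sum, Finset.mul_sum,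
      ← Finset.sum_add_distrib, ← Finset.sum_add_distrib]
    exact Finset.sum_congr rfl fun i _ => by rw [hDq']; ring
  have hSFF0 : 0 ≤ SFF := Finset.sum_nonneg fun i _ => sq_nonneg _
  have key := stretchCert_algebra (q := n ^ 2) (hx := kx) (F := F x) (mt := mt) (δ := δ) (σ := σ)
    (Ξ := Ξ) (W := W) (Lh := kt + Dk (v x) - (Δ k) x) (LF := Ft + DF (v x) - (Δ F) x)
    (by positivity) hkx hmt hFrel hkato hLq hcert hSqq' hSFF0
  rw [hFx] at key
  exact key


/-! ### The pointwise inequality at a space–time point -/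

/-- The vorticity `(t, x) ↦ curl u(t)(x)` of a classical solution on `(−∞, 0)` is jointly smooth
there. [folklore] -/
theorem isSmoothSpaceTimeOn_vorticity_Iio
    {u : ℝ → EuclideanSpace ℝ (Fin 3) → EuclideanSpace ℝ (Fin 3)}
    (hsm : IsSmoothSpaceTimeOn (Iio 0) u) : IsSmoothSpaceTimeOn (Iio 0) (vorticity u) := by
  have h1 := (hsm.isSmoothSpaceTimeOn_fderiv_of_isOpen isOpen_Iio).clm curlCLM
  have e : (fun t x => curlCLM (fderiv ℝ (u t) x)) = vorticity u := by funext s y; rfl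
  rwa [e] at h1

/-- **Kato's inequality with a stretching certificate, at a space–time point.** Let `(u, p)` be a
classical Navier–Stokes solution on `(−∞, 0) × ℝ³` and `h ≥ 1` jointly smooth there. At a point
`(t, x)`, `t < 0`, where `ω = curl u(t) ≠ 0` and the certificate inequality
`((−t)(⟪∇u ξ, ξ⟫ − |∇ξ|²_F) − 1 + δ) h ≤ (−t)(∂ₜh + u·∇h − Δh)` holds, the smooth function
`F = |ω|²/h²` satisfies
`∂ₜF + u·∇F − ΔF ≤ 2(1−δ)F/(−t) + 2h⁻¹ Σᵢ ∂ᵢF ∂ᵢh`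
(`hveq` is the vorticity equation `∂ₜω + (u·∇)ω = (ω·∇)u + Δω` at `(t, x)`, two-sided in time —
for the Type-I class see `vorticity_eq_deriv_of_typeI`; the rest is `stretchCert_slice`).
[cite: MajdaBertozziCUP2002, §2.4 Prop. 2.4 eq. (2.110)] -/
theorem stretchCert_F_subsolution
    {u : ℝ → EuclideanSpace ℝ (Fin 3) → EuclideanSpace ℝ (Fin 3)}
    {h : ℝ → EuclideanSpace ℝ (Fin 3) → ℝ}
    (hsm : IsSmoothSpaceTimeOn (Iio 0) u) (hh : IsSmoothSpaceTimeOn (Iio 0) h)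
    (hh1 : ∀ t < 0, ∀ y, 1 ≤ h t y) {δ t : ℝ} (ht : t < 0) {x : EuclideanSpace ℝ (Fin 3)}
    (hω : curl (u t) x ≠ 0)
    (hveq : deriv (fun s => curl (u s) x) t + fderiv ℝ (curl (u t)) x (u t x) =
      fderiv ℝ (u t) x (curl (u t) x) + (Δ (curl (u t))) x)
    (hcert : ((-t) * (⟪fderiv ℝ (u t) x (vorticityDirection (curl (u t)) x),
        vorticityDirection (curl (u t)) x⟫
        - frobeniusNormSq (fderiv ℝ (vorticityDirection (curl (u t))) x)) - 1 + δ) * h t x ≤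
      (-t) * (timeDeriv h t x + fderiv ℝ (h t) x (u t x) - (Δ (h t)) x)) :
    deriv (fun s => ‖curl (u s) x‖ ^ 2 / h s x ^ 2) t
        + fderiv ℝ (fun y => ‖curl (u t) y‖ ^ 2 / h t y ^ 2) x (u t x)
        - (Δ fun y => ‖curl (u t) y‖ ^ 2 / h t y ^ 2) x ≤
      2 * (1 - δ) / (-t) * (‖curl (u t) x‖ ^ 2 / h t x ^ 2)
        + 2 * (h t x)⁻¹ * ∑ i, fderiv ℝ (fun y => ‖curl (u t) y‖ ^ 2 / h t y ^ 2) x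
            (stdOrthonormalBasis ℝ (EuclideanSpace ℝ (Fin 3)) i)
          * fderiv ℝ (h t) x (stdOrthonormalBasis ℝ (EuclideanSpace ℝ (Fin 3)) i) := by
  have ht' : t ∈ Iio (0 : ℝ) := ht
  have hvort : IsSmoothSpaceTimeOn (Iio 0) (vorticity u) := isSmoothSpaceTimeOn_vorticity_Iio hsm
  have hOm : ContDiff ℝ 2 (curl (u t)) := (hvort.contDiff_slice ht').of_le (by norm_cast)
  have hk : ContDiff ℝ 2 (h t) := (hh.contDiff_slice ht').of_le (by norm_cast)
  have hk0 : ∀ y, h t y ≠ 0 := fun y => (lt_of_lt_of_le one_pos (hh1 t ht y)).ne'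
  have hkx : 0 < h t x := lt_of_lt_of_le one_pos (hh1 t ht x)
  -- time derivatives of `s ↦ ω(s, x)`, `s ↦ h(s, x)` and `s ↦ F(s, x)`
  have hOmt : HasDerivAt (fun s => curl (u s) x) (deriv (fun s => curl (u s) x) t) t :=
    hvort.hasDerivAt_timeLine isOpen_Iio ht' x
  have hqt : HasDerivAt (fun s => ‖curl (u s) x‖ ^ 2)
      (2 * ⟪curl (u t) x, deriv (fun s => curl (u s) x) t⟫) t := hOmt.norm_sq
  have hkt : HasDerivAt (fun s => h s x) (deriv (fun s => h s x) t) t :=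
    hh.hasDerivAt_timeLine isOpen_Iio ht' x
  have hk2t : HasDerivAt (fun s => h s x ^ 2) (↑(2 : ℕ) * h t x ^ (2 - 1) * deriv (fun s => h s x) t) t :=
    hkt.pow 2
  have hFt : HasDerivAt (fun s => ‖curl (u s) x‖ ^ 2 / h s x ^ 2)
      ((2 * ⟪curl (u t) x, deriv (fun s => curl (u s) x) t⟫ * h t x ^ 2
        - ‖curl (u t) x‖ ^ 2 * (↑(2 : ℕ) * h t x ^ (2 - 1) * deriv (fun s => h s x) t))
        / (h t x ^ 2) ^ 2) t :=
    hqt.div hk2t (pow_ne_zero 2 (hk0 x))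
  have htime : 2 * ⟪curl (u t) x, deriv (fun s => curl (u s) x) t⟫ =
      h t x ^ 2 * deriv (fun s => ‖curl (u s) x‖ ^ 2 / h s x ^ 2) t
        + 2 * (‖curl (u t) x‖ ^ 2 / h t x ^ 2) * h t x * deriv (fun s => h s x) t := by
    rw [hFt.deriv]
    field_simp
    ring
  rw [timeDeriv_apply] at hcert
  exact stretchCert_slice hOm hk hk0 hω hkx (neg_pos.2 ht) htime hveq hcert


/-- **The vorticity equation of a Type-I ancient mild field, two-sided in time**: for `u ∈ A_C`
and `t < 0`, `∂ₜω + (u·∇)ω = (ω·∇)u + Δω` at `(t, x)` with `∂ₜ` the two-sided derivative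
(`u` is classical on the window `(2t, 0)` for some smooth pressure,
`IsTypeIAncientMild.exists_isClassicalNSSolutionOn_Ioo`; the curl of the momentum equation is
`IsClassicalNSSolutionOn.vorticity_eq`). [cite: MajdaBertozziCUP2002, §2.4 Prop. 2.4 eq. (2.110)] -/
theorem vorticity_eq_deriv_of_typeI {C : ℝ}
    {u : ℝ → EuclideanSpace ℝ (Fin 3) → EuclideanSpace ℝ (Fin 3)} (hu : IsTypeIAncientMild C u)
    {t : ℝ} (ht : t < 0) (x : EuclideanSpace ℝ (Fin 3)) :
    deriv (fun s => curl (u s) x) t + fderiv ℝ (curl (u t)) x (u t x) =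
      fderiv ℝ (u t) x (curl (u t) x) + (Δ (curl (u t))) x := by
  have h2t : 2 * t < 0 := by linarith
  obtain ⟨p, hcl⟩ := hu.exists_isClassicalNSSolutionOn_Ioo h2t
  have ht' : t ∈ Ioo (2 * t) 0 := ⟨by linarith, ht⟩
  have hveq := (hcl.isVorticitySolutionOn_zero_force isOpen_Ioo.uniqueDiffOn
    (by rw [interior_Ioo]; exact subset_closure)).vorticity_eq t ht' x
  simp only [timeDerivWithin_eq_deriv isOpen_Ioo ht', convect_apply, vorticity_apply,
    one_smul] at hveq
  exact hveq

end Summit.NavierStokesRegularity.NavierStokesRegularity.Theorems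

end
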